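import Mathlib
import Summits.NavierStokesRegularity.NavierStokesRegularity.Theorems.SubOnsagerCeilingSideBranchParkingReduction
import HarnessLib

/-!
# Route SubOnsagerCeiling — the uniform parking bound is only needed ON HORIZONS (operative reduction, def-free)
# (helper file for item stmt-NavierStokesRegularity-25507 `OrthantTailCeiling`; `--supports`)

Companion of `…SideBranchParkingReduction.lean` (p826859).  There the UNIFORM PARKING BOUND was asked on
every window `[0,s]`, `s > 0`, at a viscosity threshold depending on the depth `K` only.  The reduction
actually uses the bound at ONE time, the block-relaxation horizon `T₀ = T₀(K, C, θ, q, ε₀)`, which does not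
depend on the viscosity.  So it suffices to ask the parking bound ON HORIZONS: for every depth `K` and every
horizon `T > 0` a threshold `ν₀ = ν₀(K, T)` such that the first `K+1` pockets hold `≤ (1 − q)E₀` on all
windows `[0,s]` with `s ≤ T`.  This is the form in which bounds carrying viscous factors `e^{ν_{j+1}t}` (the
capture law p826926) can be fed in — with `ν ≤ ν₀(K,T)` such factors are harmless, whereas for fixed `ν`
and `t → ∞` they are not.

* **`sideBranchCeilingEscapeAt_of_parkingBoundOnHorizons`** — PARKING BOUND ON HORIZONS (`q`)
  `⇒ SideBranchCeilingEscapeAt ε₀`;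
* `orthantTailCeiling_false_of_parkingBoundOnHorizons`, `forwardTailCeiling_false_of_parkingBoundOnHorizons`
  — the aside cruxes stmt-25507 / stmt-26608 BY NAME modulo it.

HONEST FRAMING: MODEL lattice ODEs only (Tao 2016 §4 vocabulary; rung TL-M2Break); a reduction between
unproved statements plus elementary real analysis; settles nothing by itself; nothing here is a statement
about the Navier–Stokes equations. [cite: Tao2016AveragedNS, §4 (4.2)–(4.3), (4.5)];
Katz–Pavlović couplings: [cite: BarbatoMorandinRomito2011, §2].
-/

noncomputable section

-- the sub-problem namespace `NavierStokesRegularity.NavierStokesRegularity` is the tree's layout (D-0017)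
set_option linter.dupNamespace false

namespace Summit.NavierStokesRegularity.NavierStokesRegularity.Theorems.SubOnsagerCeiling

open Set Filter
open scoped Topology
open Literature.Analysis.FluidPDE.TaoCascade
open Summit.NavierStokesRegularity.NavierStokesRegularity.Theses.SubOnsagerCeiling

/-- **UNIFORM PARKING BOUND ON HORIZONS `→ SideBranchCeilingEscapeAt ε₀`** — the OPERATIVE form of
`sideBranchCeilingEscapeAt_of_parkingBound`: the hypothesis is asked only on windows `[0,s]` with `s ≤ T`, for
EVERY horizon `T > 0`, with a viscosity threshold `ν₀ = ν₀(K, T)` that may depend on the horizon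
(`∀ K, ∀ T > 0, ∃ ν₀ > 0, ∀ 0 < ν ≤ ν₀, ∀ 0 < s ≤ T, …`).  This is strictly weaker as a hypothesis (so the
theorem is stronger), and it is the form in which time-integrated bounds with viscous factors `e^{ν_{j+1}t}`
(capture law) can be fed in.  Proof: as before — the block relaxation horizon `T₀` does not depend on `ν`, so
the hypothesis is invoked at `(K, T₀)` and `s = T₀`.  MODEL lattice only; a reduction between unproved
statements. [this file] -/
theorem sideBranchCeilingEscapeAt_of_parkingBoundOnHorizons {ε₀ q : ℝ} (hε : 0 < ε₀) (hq : 0 < q)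
    (h : ∀ θ : ℝ, 1 / 2 < θ → ∀ C : ℝ, 0 ≤ C →
      ∃ X₀ : Fin 4 → ℝ, 0 ≤ X₀ 0 ∧ 0 ≤ X₀ 1 ∧ 0 ≤ X₀ 2 ∧ X₀ 3 = 0 ∧
      0 < (∑ i : Fin 4, (1 / 2 : ℝ) * X₀ i ^ 2) ∧
      ∀ K : ℕ, ∀ T : ℝ, 0 < T → ∃ ν₀ : ℝ, 0 < ν₀ ∧ ∀ ν : ℝ, 0 < ν → ν ≤ ν₀ →
      ∀ s : ℝ, 0 < s → s ≤ T →
      ∀ X : Fin 4 → ℤ → ℝ → ℝ,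
      (∀ (i : Fin 4) (k : ℤ), X i k 0 = if k = 0 then X₀ i else 0) →
      (∀ (i : Fin 4) (k : ℤ), k < 0 → ∀ t : ℝ, X i k t = 0) →
      (∃ M : ℝ, ∀ (t : ℝ) (i : Fin 4) (k : ℤ), (1 + (1 + ε₀) ^ ((10 : ℝ) * k)) * |X i k t| ≤ M) →
      (∀ (i : Fin 4) (k : ℤ), Continuous (X i k)) →
      (∀ (i : Fin 4) (k : ℤ), ∀ t ∈ Set.Icc (0 : ℝ) s, HasDerivWithinAt (X i k)
      (quadTerm ε₀ sideBranchTable X i k t - ν * (1 + ε₀) ^ ((2 : ℝ) * k) * X i k t)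
      (Set.Icc (0 : ℝ) s) t) →
      (∀ t ∈ Set.Icc (0 : ℝ) s, ∀ (i : Fin 4) (k : ℤ), 1 ≤ k → 0 ≤ X i k t) →
      (∀ n N : ℕ, n ≤ N → ∀ u ∈ Set.Icc (0 : ℝ) s,
      ∑ k ∈ Finset.Icc n N, ∑ i : Fin 4, (1 / 2 : ℝ) * X i (k : ℤ) u ^ 2 ≤
      C * (∑ i : Fin 4, (1 / 2 : ℝ) * X₀ i ^ 2) * (1 + ε₀) ^ (-(2 * θ * (n : ℝ)))) →
      ∀ t ∈ Set.Icc (0 : ℝ) s,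
      (∑ j ∈ Finset.range (K + 1), (1 / 2 : ℝ) * X 2 (j : ℤ) t ^ 2) ≤
      (1 - q) * (∑ i : Fin 4, (1 / 2 : ℝ) * X₀ i ^ 2)) :
    SideBranchCeilingEscapeAt ε₀ := by
  refine sideBranchCeilingEscapeAt_of_fractionEscape hε (half_pos hq) fun θ hθ C hC => ?_
  obtain ⟨X₀, hX0, hX1, hX2, hX3, hE₀, hK⟩ := h θ hθ C hC
  set E₀ : ℝ := ∑ i : Fin 4, (1 / 2 : ℝ) * X₀ i ^ 2 with hE₀def
  refine ⟨X₀, hE₀, fun K => ?_⟩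
  -- cap and level
  set Z : ℝ := Real.sqrt (2 * C * E₀) + 1 with hZdef
  have hZ : 0 < Z := by have := Real.sqrt_nonneg (2 * C * E₀); rw [hZdef]; linarith
  set ρ : ℝ := min 1 (q / 2 * E₀ / ((K : ℝ) + 1)) with hρdef
  have hρ : 0 < ρ := lt_min one_pos (by positivity)
  have hρ1 : ρ ≤ 1 := min_le_left _ _
  have hρq : ((K : ℝ) + 1) * ρ ^ 2 ≤ q / 2 * E₀ := by
    have h1 : ρ ^ 2 ≤ ρ := by nlinarith
    have h2 : ρ ≤ q / 2 * E₀ / ((K : ℝ) + 1) := min_le_right _ _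
    have h3 : ((K : ℝ) + 1) * ρ ≤ q / 2 * E₀ := by
      rw [le_div_iff₀ (by positivity)] at h2; linarith
    have h4 : ((K : ℝ) + 1) * ρ ^ 2 ≤ ((K : ℝ) + 1) * ρ := mul_le_mul_of_nonneg_left h1 (by positivity)
    linarith
  obtain ⟨T₀, hT₀, ν₀', hν₀', hblock⟩ := sideBranch_block_transit_relax hε hZ K hρ
  obtain ⟨ν₀'', hν₀'', hpark⟩ := hK K T₀ hT₀
  refine ⟨T₀, hT₀, min ν₀' ν₀'', lt_min hν₀' hν₀'', fun ν hν hνle => ⟨T₀, hT₀, le_rfl, ?_⟩⟩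
  intro X hinit hlow hbd hcont hder hpos hceil
  have hν1 : ν ≤ ν₀' := hνle.trans (min_le_left _ _)
  have hν2 : ν ≤ ν₀'' := hνle.trans (min_le_right _ _)
  -- signs on every shell `≥ 0`
  have hx00 : 0 ≤ X 0 0 0 := by rw [hinit 0 0]; simpa using hX0
  have hs00 : 0 ≤ X 1 0 0 := by rw [hinit 1 0]; simpa using hX1
  have hz00 : 0 ≤ X 2 0 0 := by rw [hinit 2 0]; simpa using hX2
  have hw0 : ∀ k : ℤ, X 3 k 0 = 0 := by
    intro k; rw [hinit 3 k]; by_cases hk : k = 0 <;> simp [hk, hX3]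
  have hposAll : ∀ t ∈ Icc (0 : ℝ) T₀, ∀ (i : Fin 4) (j : ℤ), 0 ≤ j → 0 ≤ X i j t := by
    intro t ht i j hj
    rcases lt_or_eq_of_le hj with hj1 | hj0
    · exact hpos t ht i j (by omega)
    · subst hj0
      fin_cases i
      · exact sideBranch_chain_zero_nonneg hlow hcont hder hx00 ht
      · exact sideBranch_side_zero_nonneg hε hcont hder hs00 ht
      · exact sideBranch_pocket_zero_nonneg hε hder hz00 ht
      · exact (sideBranch_idle_eq_zero hder 0 (hw0 0) ht).symm.le
  -- the pocket cap from the ceiling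
  have hcap : ∀ t ∈ Icc (0 : ℝ) T₀, ∀ j : ℤ, X 2 j t ≤ Z := by
    intro t ht j
    have h1 := sideBranch_pocket_le_of_ceiling (X := X) hε (by linarith : (0 : ℝ) ≤ θ) hC hE₀.le hlow
      hceil ht j
    rw [hZdef]; linarith
  -- block relaxation at `u = T₀`
  have hrel := hblock ν hν hν1 T₀ X hlow hder hposAll hcap T₀ ⟨le_rfl, le_rfl⟩
  -- parking bound at `t = T₀` (window `s = T₀ ≤ T₀`)
  have hpk := hpark ν hν hν2 T₀ hT₀ le_rfl X hinit hlow hbd hcont hder hpos hceil T₀ ⟨hT₀.le, le_rfl⟩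
  -- bookkeeping: block energy = transit part + pockets (idle = 0)
  have hT₀mem : T₀ ∈ Icc (0 : ℝ) T₀ := ⟨hT₀.le, le_rfl⟩
  have hsplit : (∑ k ∈ Finset.range (K + 1), ∑ i : Fin 4, (1 / 2 : ℝ) * X i (k : ℤ) T₀ ^ 2) =
      (∑ k ∈ Finset.range (K + 1), ((1 / 2 : ℝ) * X 0 (k : ℤ) T₀ ^ 2 + (1 / 2 : ℝ) * X 1 (k : ℤ) T₀ ^ 2)) +
        ∑ k ∈ Finset.range (K + 1), (1 / 2 : ℝ) * X 2 (k : ℤ) T₀ ^ 2 := by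
    rw [← Finset.sum_add_distrib]
    refine Finset.sum_congr rfl fun k _ => ?_
    rw [Fin.sum_univ_four, sideBranch_idle_eq_zero hder (k : ℤ) (hw0 k) hT₀mem]
    ring
  have htransit := sideBranch_block_transit_energy (X := X) (K := K) (ρ := ρ) (u := T₀)
    (fun k _ => ⟨hposAll T₀ hT₀mem 0 k (by positivity), hposAll T₀ hT₀mem 1 k (by positivity)⟩)
    (fun k hk => hrel k hk)
  rw [hsplit]
  have : (1 - q / 2) * E₀ = q / 2 * E₀ + (1 - q) * E₀ := by ring
  rw [this]
  exact add_le_add (htransit.trans hρq) hpk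

/-- **`OrthantTailCeiling` (stmt-25507) BY NAME modulo the uniform parking bound ON HORIZONS at some
`ε₀ ∈ (0,1]`** (hypothesis inline, shape of `sideBranchCeilingEscapeAt_of_parkingBoundOnHorizons`).  MODEL
lattice only; conditional; settles nothing by itself. [this file] -/
theorem orthantTailCeiling_false_of_parkingBoundOnHorizons
    (h : ∃ ε₀ : ℝ, 0 < ε₀ ∧ ε₀ ≤ 1 ∧ ∃ q : ℝ, 0 < q ∧
      ∀ θ : ℝ, 1 / 2 < θ → ∀ C : ℝ, 0 ≤ C →
      ∃ X₀ : Fin 4 → ℝ, 0 ≤ X₀ 0 ∧ 0 ≤ X₀ 1 ∧ 0 ≤ X₀ 2 ∧ X₀ 3 = 0 ∧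
      0 < (∑ i : Fin 4, (1 / 2 : ℝ) * X₀ i ^ 2) ∧
      ∀ K : ℕ, ∀ T : ℝ, 0 < T → ∃ ν₀ : ℝ, 0 < ν₀ ∧ ∀ ν : ℝ, 0 < ν → ν ≤ ν₀ →
      ∀ s : ℝ, 0 < s → s ≤ T →
      ∀ X : Fin 4 → ℤ → ℝ → ℝ,
      (∀ (i : Fin 4) (k : ℤ), X i k 0 = if k = 0 then X₀ i else 0) →
      (∀ (i : Fin 4) (k : ℤ), k < 0 → ∀ t : ℝ, X i k t = 0) →
      (∃ M : ℝ, ∀ (t : ℝ) (i : Fin 4) (k : ℤ), (1 + (1 + ε₀) ^ ((10 : ℝ) * k)) * |X i k t| ≤ M) →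
      (∀ (i : Fin 4) (k : ℤ), Continuous (X i k)) →
      (∀ (i : Fin 4) (k : ℤ), ∀ t ∈ Set.Icc (0 : ℝ) s, HasDerivWithinAt (X i k)
      (quadTerm ε₀ sideBranchTable X i k t - ν * (1 + ε₀) ^ ((2 : ℝ) * k) * X i k t)
      (Set.Icc (0 : ℝ) s) t) →
      (∀ t ∈ Set.Icc (0 : ℝ) s, ∀ (i : Fin 4) (k : ℤ), 1 ≤ k → 0 ≤ X i k t) →
      (∀ n N : ℕ, n ≤ N → ∀ u ∈ Set.Icc (0 : ℝ) s,
      ∑ k ∈ Finset.Icc n N, ∑ i : Fin 4, (1 / 2 : ℝ) * X i (k : ℤ) u ^ 2 ≤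
      C * (∑ i : Fin 4, (1 / 2 : ℝ) * X₀ i ^ 2) * (1 + ε₀) ^ (-(2 * θ * (n : ℝ)))) →
      ∀ t ∈ Set.Icc (0 : ℝ) s,
      (∑ j ∈ Finset.range (K + 1), (1 / 2 : ℝ) * X 2 (j : ℤ) t ^ 2) ≤
      (1 - q) * (∑ i : Fin 4, (1 / 2 : ℝ) * X₀ i ^ 2)) :
    ¬ OrthantTailCeiling := by
  obtain ⟨ε₀, hε, hε1, q, hq, hpark⟩ := h
  exact orthantTailCeiling_false_of_sideBranchCeilingEscape
    ⟨ε₀, hε, hε1, sideBranchCeilingEscapeAt_of_parkingBoundOnHorizons hε hq hpark⟩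

/-- **`ForwardTailCeiling` (stmt-26608) BY NAME modulo the uniform parking bound ON HORIZONS at some
`ε₀ ∈ (0,1]`** (twin reduction of record).  MODEL lattice only; conditional; settles nothing by itself.
[this file] -/
theorem forwardTailCeiling_false_of_parkingBoundOnHorizons
    (h : ∃ ε₀ : ℝ, 0 < ε₀ ∧ ε₀ ≤ 1 ∧ ∃ q : ℝ, 0 < q ∧
      ∀ θ : ℝ, 1 / 2 < θ → ∀ C : ℝ, 0 ≤ C →
      ∃ X₀ : Fin 4 → ℝ, 0 ≤ X₀ 0 ∧ 0 ≤ X₀ 1 ∧ 0 ≤ X₀ 2 ∧ X₀ 3 = 0 ∧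
      0 < (∑ i : Fin 4, (1 / 2 : ℝ) * X₀ i ^ 2) ∧
      ∀ K : ℕ, ∀ T : ℝ, 0 < T → ∃ ν₀ : ℝ, 0 < ν₀ ∧ ∀ ν : ℝ, 0 < ν → ν ≤ ν₀ →
      ∀ s : ℝ, 0 < s → s ≤ T →
      ∀ X : Fin 4 → ℤ → ℝ → ℝ,
      (∀ (i : Fin 4) (k : ℤ), X i k 0 = if k = 0 then X₀ i else 0) →
      (∀ (i : Fin 4) (k : ℤ), k < 0 → ∀ t : ℝ, X i k t = 0) →
      (∃ M : ℝ, ∀ (t : ℝ) (i : Fin 4) (k : ℤ), (1 + (1 + ε₀) ^ ((10 : ℝ) * k)) * |X i k t| ≤ M) →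
      (∀ (i : Fin 4) (k : ℤ), Continuous (X i k)) →
      (∀ (i : Fin 4) (k : ℤ), ∀ t ∈ Set.Icc (0 : ℝ) s, HasDerivWithinAt (X i k)
      (quadTerm ε₀ sideBranchTable X i k t - ν * (1 + ε₀) ^ ((2 : ℝ) * k) * X i k t)
      (Set.Icc (0 : ℝ) s) t) →
      (∀ t ∈ Set.Icc (0 : ℝ) s, ∀ (i : Fin 4) (k : ℤ), 1 ≤ k → 0 ≤ X i k t) →
      (∀ n N : ℕ, n ≤ N → ∀ u ∈ Set.Icc (0 : ℝ) s,
      ∑ k ∈ Finset.Icc n N, ∑ i : Fin 4, (1 / 2 : ℝ) * X i (k : ℤ) u ^ 2 ≤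
      C * (∑ i : Fin 4, (1 / 2 : ℝ) * X₀ i ^ 2) * (1 + ε₀) ^ (-(2 * θ * (n : ℝ)))) →
      ∀ t ∈ Set.Icc (0 : ℝ) s,
      (∑ j ∈ Finset.range (K + 1), (1 / 2 : ℝ) * X 2 (j : ℤ) t ^ 2) ≤
      (1 - q) * (∑ i : Fin 4, (1 / 2 : ℝ) * X₀ i ^ 2)) :
    ¬ ForwardTailCeiling := by
  obtain ⟨ε₀, hε, hε1, q, hq, hpark⟩ := h
  exact forwardTailCeiling_false_of_sideBranchCeilingEscape
    ⟨ε₀, hε, hε1, sideBranchCeilingEscapeAt_of_parkingBoundOnHorizons hε hq hpark⟩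

end Summit.NavierStokesRegularity.NavierStokesRegularity.Theorems.SubOnsagerCeiling

end
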